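import Mathlib.RingTheory.KrullDimension.Basic
import Mathlib.RingTheory.Spectrum.Prime.Topology
import Mathlib.RingTheory.Localization.AtPrime.Basic
import HarnessLib

/-!
# The Krull dimension of a localization does not exceed that of the ring

Topic: `Literature/RingTheory/KrullDimension`. For a localization `S⁻¹R` of a commutative ring `R`,
the primes of `S⁻¹R` are in inclusion-preserving bijection with the primes of `R` not meeting `S`
(Atiyah–Macdonald, Prop. 3.11 (iv)), so every chain of primes of `S⁻¹R` contracts to a chain of the
same length in `R` and `dim S⁻¹R ≤ dim R`:

* `ringKrullDim_le_of_isLocalization` — `ringKrullDim S ≤ ringKrullDim R` for `[IsLocalization M S]`;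
* `ringKrullDim_localization_le` — the same for Mathlib's model `Localization M`;
* `ringKrullDim_localization_atPrime_le` — `dim R_𝔭 ≤ dim R`.

(Mathlib has the injectivity of the contraction map, `PrimeSpectrum.localization_comap_injective`,
and the analogous bound for surjections, `ringKrullDim_le_of_surjective`; the tree's
`FibreDimension.ringKrullDim_eq_of_isLocalization` is the EQUALITY for affine domains at
non-zero-divisors, and `BlowupReducedDimension.ringKrullDim_le_of_isLocalization_chart` a local-ring
variant with extra hypotheses.) Everything is proved; no named facts.

## References

* M. F. Atiyah, I. G. Macdonald, *Introduction to Commutative Algebra* (1969), Prop. 3.11 (iv).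
  [AtiyahMacdonald1969]
-/

namespace Literature.RingTheory.KrullDimension

/-- **`dim S⁻¹R ≤ dim R`**: contraction of primes along `R → S⁻¹R` is injective and monotone
(the primes of `S⁻¹R` are the primes of `R` not meeting `S`, Atiyah–Macdonald Prop. 3.11 (iv)),
hence strictly monotone, and the Krull dimension can only drop. [cite: AtiyahMacdonald1969, Prop. 3.11 (iv)] -/
theorem ringKrullDim_le_of_isLocalization {R : Type*} [CommRing R] (M : Submonoid R) (S : Type*)
    [CommRing S] [Algebra R S] [IsLocalization M S] : ringKrullDim S ≤ ringKrullDim R :=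
  Order.krullDim_le_of_strictMono (PrimeSpectrum.comap (algebraMap R S))
    (Monotone.strictMono_of_injective (fun _ _ hab => Ideal.comap_mono hab)
      (PrimeSpectrum.localization_comap_injective S M))

/-- `dim (Localization M) ≤ dim R`. [cite: AtiyahMacdonald1969, Prop. 3.11 (iv)] -/
theorem ringKrullDim_localization_le {R : Type*} [CommRing R] (M : Submonoid R) :
    ringKrullDim (Localization M) ≤ ringKrullDim R :=
  ringKrullDim_le_of_isLocalization M (Localization M)

/-- `dim R_𝔭 ≤ dim R` for a prime `𝔭`. [cite: AtiyahMacdonald1969, Prop. 3.11 (iv)] -/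
theorem ringKrullDim_localization_atPrime_le {R : Type*} [CommRing R] (p : Ideal R) [p.IsPrime] :
    ringKrullDim (Localization.AtPrime p) ≤ ringKrullDim R :=
  ringKrullDim_le_of_isLocalization p.primeCompl (Localization.AtPrime p)

end Literature.RingTheory.KrullDimension
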